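import Literature.AlgebraicGeometry.AbelianVarieties.CechH1DimOfCharZeroByTransport
import Literature.AlgebraicGeometry.Motives.AbelianVarietyConjugate
import HarnessLib

/-!
# `Ȟ¹(𝔘, 𝒪_B)` of an abelian variety over a field with a place into `ℂ`: finiteness, `dim ≤ dim B`, and the carrier
# comparison along `σ : k →+* ℂ` (Mumford AV §13 Cor. 2; flat base change, Hartshorne III 9.3)

Layer `Literature/AlgebraicGeometry/AbelianSchemes`, namespace `Literature.AlgebraicGeometry.AbelianSchemes`.  THEOREMS ONLY (no definition, no
named fact, no instance, no `sorry`).  The two (I2-B) letters of the F-11 α1-(iii-c-2) sockets file (`SOCKETS-I2.v0`, F0P1b-p03; planner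
ruling (R23)), restated BINDER FOR BINDER and proved:

* `AbelianVariety.finite_and_finrank_cechH1_le_dim_of_ringHom_complex` — for an abelian variety `B` over a field `k` admitting a ring
  homomorphism `σ : k →+* ℂ` and every finite affine open cover `V` of `B`: `Ȟ¹(V, 𝒪_B)` (the tree's `Morphisms.CechH1 B.X.hom V`) is
  finite-dimensional over `k` of dimension `≤ dim B` (in fact `= dim B`);
* `AbelianVariety.cechH1_carrier_baseChangeAlong` — the carrier half: along `σ`, with `π : σB → B` the projection
  (`Motives.baseChangeHomFst σ B.X`), the preimages `π⁻¹V_i` form a finite affine open cover of `σB`, and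
  `finrank_k Ȟ¹(V, 𝒪_B) = finrank_ℂ Ȟ¹(π⁻¹V, 𝒪_{σB})` (with the finiteness over `k`).

Both are BY NAME over the tree's Lefschetz-principle theorem `AbelianVarieties.finrank_cechH1_structureSheaf_eq_dim_of_charZero`
(`dim_K Ȟ¹(𝔘, 𝒪_A) = dim A` for EVERY field `K` of characteristic `0` and every finite affine cover — Mumford §13 Cor. 2 transported from `ℂ`
by spreading out and flat base change, `AbelianVarieties/CechH1DimOfCharZeroByTransport`): a field with a ring homomorphism to `ℂ` has
characteristic `0` (`RingHom.charZero`), both `B` and `σB` are abelian varieties over fields of characteristic `0` of the same dimension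
(`AbelianVariety.dim_baseChangeAlong`), and `π` is affine (a base change of `Spec ℂ → Spec k`), so preimages of affine opens are affine.
No new geometry; the flat-base-change comparison map itself is not needed for the two letters and is not restated here
(`Morphisms/CechH1FlatBaseChangeRank.nonempty_cechH1_baseChange_linearEquiv` has it).

Cell `hodgecm-mathlib`, F-11 grandchild `F11LiftWithLineBundle` G2 (iii-c-2) «`φ_{L_s}` onto», (I2-B) pair (W4-1); consumer F0P1b-p03's
(I2-C) assembly `AbelianSchemes/PhiLOntoCharZero`.  HC_CM is proved only modulo the 7 printed citations until rung 0 closes; nothing here is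
about HC.  Mathlib searched (pin v4.32): `RingHom.charZero`, `MorphismProperty.pullback_fst`, `IsAffineOpen.preimage`,
`Scheme.Hom.iSup_preimage_eq_top` (used); Mathlib has no Čech cohomology of schemes.

## References
* [MumfordAV1970] D. Mumford, *Abelian Varieties* (1970), §13 Cor. 2 (p. 129).
* [Hartshorne1977] R. Hartshorne, *Algebraic Geometry* (1977), III Prop. 9.3 (p. 255) (flat base change), III Thm. 4.5 (p. 222).
* [StacksProject] The Stacks Project, Tag 02KH (flat base change of cohomology), Tag 01ED (Čech cohomology).
-/

noncomputable section

open CategoryTheory CategoryTheory.Limits AlgebraicGeometry Opposite TopologicalSpace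

namespace Literature.AlgebraicGeometry.AbelianSchemes

open Literature.AlgebraicGeometry.Motives Literature.AlgebraicGeometry.Morphisms Literature.AlgebraicGeometry.AbelianVarieties

variable {k : Type} [Field k]

/-! ## §1 The projection `π : σB → B` is affine; preimages of affine covers -/

/-- A field with a ring homomorphism into `ℂ` has characteristic `0`. [folklore] [cite: Hartshorne1977, III Prop. 9.3 (p. 255)] -/
theorem charZero_of_ringHom_complex (σ : k →+* ℂ) : CharZero k := σ.charZero

/-- **The projection `π : X_σ = X ×_{k,σ} ℂ → X` is affine** (base change of the affine morphism `Spec ℂ → Spec k`).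
[cite: Hartshorne1977, III Prop. 9.3 (p. 255)] -/
theorem isAffineHom_baseChangeHomFst (σ : k →+* ℂ) (X : SchemeOver k) : IsAffineHom (baseChangeHomFst σ X) :=
  MorphismProperty.pullback_fst (P := @IsAffineHom) _ _ inferInstance

/-- **Preimages of a finite affine open cover of `B` under `π : σB → B` form a finite affine open cover of `σB`.**
[cite: Hartshorne1977, III Prop. 9.3 (p. 255)] -/
theorem isAffineOpen_preimage_baseChangeHomFst (σ : k →+* ℂ) (X : SchemeOver k) {ι : Type} (V : ι → X.left.Opens)
    (hVaff : ∀ i, IsAffineOpen (V i)) (hV : iSup V = ⊤) :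
    (∀ i, IsAffineOpen (baseChangeHomFst σ X ⁻¹ᵁ (V i))) ∧ (⨆ i, baseChangeHomFst σ X ⁻¹ᵁ (V i)) = ⊤ :=
  haveI := isAffineHom_baseChangeHomFst σ X
  ⟨fun i => (hVaff i).preimage _, (baseChangeHomFst σ X).iSup_preimage_eq_top hV⟩

/-! ## §2 The two (I2-B) letters -/

/-- **`dim_k Ȟ¹(V, 𝒪_B) = dim B` (hence finite) for an abelian variety over a field with a place `σ : k →+* ℂ`**, on every finite affine
open cover — Mumford §13 Cor. 2 over a field of characteristic `0` (`RingHom.charZero σ`), by name over the tree's Lefschetz transport.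
[cite: MumfordAV1970, §13 Cor. 2 (p. 129)] -/
theorem AbelianVariety.finite_and_finrank_cechH1_eq_dim_of_ringHom_complex (σ : k →+* ℂ) (B : AbelianVariety k)
    (ι : Type) [Finite ι] (V : ι → B.X.left.Opens) (hVaff : ∀ i, IsAffineOpen (V i)) (hV : iSup V = ⊤) :
    Module.Finite k (CechH1 B.X.hom V) ∧ Module.finrank k (CechH1 B.X.hom V) = B.dim :=
  haveI := charZero_of_ringHom_complex σ
  finrank_cechH1_structureSheaf_eq_dim_of_charZero B V hVaff hV

/-- **(I2-B) letter, verbatim** — for an abelian variety `B` over a field `k` with a ring map `σ : k →+* ℂ` and every finite affine open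
cover `V` of `B`: `Ȟ¹(V, 𝒪_B)` is finite-dimensional over `k` of dimension `≤ dim B` (the socket
`socket_I2B_finite_and_finrank_cechH1_le_dim` of `SOCKETS-I2.v0`, binder for binder). [cite: MumfordAV1970, §13 Cor. 2 (p. 129)] -/
theorem AbelianVariety.finite_and_finrank_cechH1_le_dim_of_ringHom_complex (σ : k →+* ℂ) (B : AbelianVariety k)
    (ι : Type) [Finite ι] (V : ι → B.X.left.Opens) (hVaff : ∀ i, IsAffineOpen (V i)) (hV : iSup V = ⊤) :
    Module.Finite k (CechH1 B.X.hom V) ∧ Module.finrank k (CechH1 B.X.hom V) ≤ B.dim :=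
  let h := AbelianVariety.finite_and_finrank_cechH1_eq_dim_of_ringHom_complex σ B ι V hVaff hV
  ⟨h.1, h.2.le⟩

/-- **(I2-B) carrier letter, verbatim** — along `σ : k →+* ℂ`, with `π : σB → B` the projection (`Motives.baseChangeHomFst σ B.X`,
`AbelianVariety.baseChangeAlong_X`): the preimages `π⁻¹ V_i` of a finite affine open cover form a finite affine open cover of `σB`, and
`Ȟ¹(π⁻¹V, 𝒪_{σB})` finite-dimensional over `ℂ` forces `Ȟ¹(V, 𝒪_B)` finite-dimensional over `k` OF THE SAME DIMENSION (the socket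
`socket_I2B_carrier_cechH1_baseChangeAlong` of `SOCKETS-I2.v0`, binder for binder; here both dimensions equal `dim B = dim σB`, so the
finiteness hypothesis over `ℂ` is not even used). [cite: Hartshorne1977, III Prop. 9.3 (p. 255)] [cite: MumfordAV1970, §13 Cor. 2 (p. 129)] -/
theorem AbelianVariety.cechH1_carrier_baseChangeAlong (σ : k →+* ℂ) (B : AbelianVariety k)
    (ι : Type) [Finite ι] (V : ι → B.X.left.Opens) (hVaff : ∀ i, IsAffineOpen (V i)) (hV : iSup V = ⊤) :
    (∀ i, IsAffineOpen (baseChangeHomFst σ B.X ⁻¹ᵁ (V i))) ∧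
      (⨆ i, baseChangeHomFst σ B.X ⁻¹ᵁ (V i)) = ⊤ ∧
      (Module.Finite ℂ (CechH1 (B.baseChangeAlong σ).X.hom (fun i => baseChangeHomFst σ B.X ⁻¹ᵁ (V i))) →
        Module.Finite k (CechH1 B.X.hom V) ∧
          Module.finrank k (CechH1 B.X.hom V) =
            Module.finrank ℂ (CechH1 (B.baseChangeAlong σ).X.hom (fun i => baseChangeHomFst σ B.X ⁻¹ᵁ (V i)))) := by
  obtain ⟨haff, hcov⟩ := isAffineOpen_preimage_baseChangeHomFst σ B.X V hVaff hV
  refine ⟨haff, hcov, fun _ => ?_⟩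
  obtain ⟨hfin, hdim⟩ := AbelianVariety.finite_and_finrank_cechH1_eq_dim_of_ringHom_complex σ B ι V hVaff hV
  obtain ⟨-, hdimC⟩ := finrank_cechH1_structureSheaf_eq_dim_of_charZero (B.baseChangeAlong σ)
    (fun i => baseChangeHomFst σ B.X ⁻¹ᵁ (V i)) haff hcov
  exact ⟨hfin, by rw [hdim, hdimC, AbelianVariety.dim_baseChangeAlong]⟩

end Literature.AlgebraicGeometry.AbelianSchemes

end
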